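import Summits.HubbardSuperconductivity.HubbardSuperconductivity.Theorems.AnisotropyChordTransferFibre3FinXBSym
import Summits.HubbardSuperconductivity.HubbardSuperconductivity.Theorems.AnisotropyChordTransferFibre3FinXBCover

/-!
# Route `AnisotropyChord` / H0 rotor rung: FIN mid-`L` EXACT-BLOCK evaluator XB2 of the row-`N₁` objects (computable, zero data)

The second exact-block evaluator of the per-`L` row-`N₁` certificate, designed for `25 ≤ L ≤ 47` (the g5 evaluator
`…FinXBEval`/`…FinXBSym` exceeds the per-declaration kernel work ceiling from `L = 27`: mechhunt STATUS p3 g6).  Same objects and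
brackets as `…FinXBEval` (so the analytic soundness is inherited lemma by lemma in `…FinXB2Sound` / `…FinXB2Cert`); what changes is
the COST:
* the two-propagator table `T(k) = Σ_p g(p) g(p − k)` is computed at the two cell END POINTS `λ·D = la` and `λ·D = lb` from the
  masked POINT tables `gPt` (nonnegative point enclosures), by EXACT accumulation at scale `D²` (one outward rounding per entry,
  `dotP` / `rowCorr`), on the wedge `0 ≤ k₂ ≤ k₁ ≤ L/2` only, and with the involution `p₁ ↦ (k₁ − p₁) mod L` halving the row pairs
  (`tSumP`: weight 2 / 1 / 0) — `T` is nondecreasing in `λ`, so the cell table is `[T_la(k)⁻, T_lb(k)⁺]` (`tTab2`); the point wedges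
  are ARGUMENTS of the certificate (`xbCellOK2 … tlo thi`), so that a kernel fact can either recompute them (`xbCellAny2`) or consume
  literal tables certified in separate declarations (`tWedgePt L lam = <literal>`), one per cell boundary, shared by the two adjacent cells;
* the per-momentum work is tabulated once (`momTab`: `F₂(k)` and `u(k) = t(k)/2 − β(k)`; `dscTab j`: disc centre, radius, modulus
  bracket and `|φ̂|²`-bracket for the directions `j = 0` (`x̂`) and `j = 2` (`ŷ`) only — the directions `−x̂`, `−ŷ` give the complex
  conjugates, equal `|φ̂|²` and cross terms at the real level, `…FinXB2Cert`), and the objects `P, A, B, Q, B_C` are read off the tables.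
Prover seat `hubbard-h0-rotor-p3` g6; helper for piece A = stmt-HubbardSuperconductivity-23918 of rung 19089 (`--supports`, helper
class).  WHAT THIS IS NOT: nothing here proves superconductivity in the Hubbard model (rotor TARGET as worded stays FALSE, g15 verdict);
evaluator infrastructure for the FIN certificates of ONE conditional reduction.  Tree imports only; no sorry, no new axioms.
-/

set_option linter.dupNamespace false
set_option autoImplicit false

namespace Summit.HubbardSuperconductivity.HubbardSuperconductivity.Theorems.AnisotropyChord.Transfer.Fibre3

namespace FinXB

open Hole2 FinCell

/-! ## The point two-propagator wedge -/

/-- exact accumulation over two rows of point enclosures: `acc + (Σ lo·lo', Σ hi·hi')` (scale `D²`, no rounding;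
sound for nonnegative lower ends). -/
def dotP : List Iv → List Iv → ℤ × ℤ → ℤ × ℤ
  | a :: as, b :: bs, acc => dotP as bs (acc.1 + a.1 * b.1, acc.2 + a.2 * b.2)
  | _, _, acc => acc

/-- the row-pair correlation `Σ_{p₂} g(p₁, p₂)·g(s, p₂ − k₂)` (scale `D²`) added to `acc`: row `p₁` against the rotated row `s`. -/
def rowCorr (L : ℕ) (gm : List (List Iv)) (p1 s k2 : ℕ) (acc : ℤ × ℤ) : ℤ × ℤ :=
  dotP (gm.getD p1 []) ((gm.getD s []).rotate (L - k2)) acc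

/-- the involution-weighted sum over `p₁ < n` of the row-pair correlations of `(p₁, p₁ − k₁)`: the partner of `p₁` is
`σ p₁ = (k₁ − p₁) mod L` (same summand); weight 2 if `p₁ < σ p₁`, 1 if `p₁ = σ p₁`, 0 otherwise. -/
def tSumP (L : ℕ) (gm : List (List Iv)) (k1 k2 : ℕ) : ℕ → ℤ × ℤ
  | 0 => (0, 0)
  | p1 + 1 =>
    let acc := tSumP L gm k1 k2 p1
    if p1 < (k1 + L - p1) % L then
      let c := rowCorr L gm p1 ((p1 + L - k1) % L) k2 (0, 0)
      (acc.1 + 2 * c.1, acc.2 + 2 * c.2)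
    else if p1 = (k1 + L - p1) % L then rowCorr L gm p1 ((p1 + L - k1) % L) k2 acc
    else acc

/-- one outward rounding from scale `D²` to scale `D`. -/
def roundP (s : ℤ × ℤ) : Iv := (s.1 / D, cdiv s.2 D)

/-- ★ `T(k₁, k₂)` at a point, from the masked point table. -/
def tEntryP (L : ℕ) (gm : List (List Iv)) (k1 k2 : ℕ) : Iv := roundP (tSumP L gm k1 k2 L)

/-- ★ the point wedge: `T` on `0 ≤ k₂ ≤ k₁ ≤ L/2` (row `k₁` has `k₁ + 1` entries). -/
def tWedgeP (L : ℕ) (gm : List (List Iv)) : List (List Iv) :=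
  (List.range (L / 2 + 1)).map fun r1 => (List.range (r1 + 1)).map fun r2 => tEntryP L gm r1 r2

/-- the masked point table of `g(k) = 1/(2ε(k) − λ)` at `λ·D = lam` (entry `(0,0)` is `0`). -/
def gPt (L : ℕ) (lam : ℤ) : List (List Iv) := mkTab L (gAt (gresCellTab L (cosTab L) lam lam))

/-- every lower end of the point table is nonnegative (checked, used by the soundness of `dotP`). -/
def gPtNonneg (L : ℕ) (lam : ℤ) : Bool := (gPt L lam).all fun row => row.all fun I => decide (0 ≤ I.1)

/-- ★ the point wedge at `λ·D = lam`. -/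
def tWedgePt (L : ℕ) (lam : ℤ) : List (List Iv) := tWedgeP L (gPt L lam)

/-- ★ the cell table of `T` from the two point wedges (lower ends at `la`, upper ends at `lb`), unfolded to all of `k` by the
lattice symmetries (`fold`, swap). -/
def tTab2 (L : ℕ) (tlo thi : List (List Iv)) : List (List Iv) :=
  mkTab L fun k1 k2 =>
    ((getF tlo (max (fold L k1) (fold L k2)) (min (fold L k1) (fold L k2))).1,
     (getF thi (max (fold L k1) (fold L k2)) (min (fold L k1) (fold L k2))).2)

/-! ## Tabulated per-momentum work -/

/-- generic table lookup with a default. -/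
def getT {α : Type} [Inhabited α] (t : List (List α)) (i j : ℕ) : α := (t.getD i []).getD j default

/-- per momentum: `(F₂(k), u(k))` with `u = t/2 − β` (`β = c_s g + d/2`); at `k = 0`: `(F₂(0), 0)` (unused `u`). -/
def momAt (L : ℕ) (S : XBScal) (gt tt : List (List Iv)) (k1 k2 : ℕ) : Iv × Iv :=
  if k1 = 0 ∧ k2 = 0 then (S.nf2, (0, 0)) else
    let cg := imul S.cs (gAt gt k1 k2)
    let t := tAt L S gt tt k1 k2
    (iadd (ineg (iadd (iscale 2 cg) S.d)) t, isub (idivn t 2) (iadd cg (idivn S.d 2)))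

/-- the per-momentum table. -/
def momTab (L : ℕ) (S : XBScal) (gt tt : List (List Iv)) : List (List (Iv × Iv)) :=
  (List.range L).map fun k1 => (List.range L).map fun k2 => momAt L S gt tt k1 k2

/-- the disc of `φ̂_e(k)` from `u(k)` and the direction phase: `Re m = (1 − cos)u + (q/2)(1 + cos)`, `Im m = sin·(u − q/2)`,
radius `τ̄/2`. -/
def discOf (S : XBScal) (u c s : Iv) : Iv × Iv × Iv :=
  (iadd (imul (isub ione c) u) (imul (idivn S.q 2) (iadd ione c)), imul s (isub u (idivn S.q 2)), idivn S.tauBar 2)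

/-- `|φ̂|²`-bracket from the modulus bracket and the radius (cf. `n2Of`). -/
def n2OfA (ab rad : Iv) : Iv :=
  let w := iclamp (iadd ab (ipm rad))
  (max (imul (w.1, w.1) (w.1, w.1)).1 0, (imul (w.2, w.2) (w.2, w.2)).2)

/-- per direction `j` and momentum: `(re, im, rad, abs, n2)` = disc centre parts, radius, modulus bracket, `|φ̂_e(k)|²` bracket. -/
def dscAt (L : ℕ) (S : XBScal) (mt : List (List (Iv × Iv))) (ct ct4 : List Iv) (j k1 k2 : ℕ) : Iv × Iv × Iv × Iv × Iv :=
  if k1 = 0 ∧ k2 = 0 then (S.gam, (0, 0), (0, 0), absIv S.gam (0, 0), n2OfA (absIv S.gam (0, 0)) (0, 0)) else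
    match discOf S (getT mt k1 k2).2 (cosAt L ct j k1 k2) (sinAt L ct4 j k1 k2) with
    | (re, im, rad) =>
      let ab := absIv re im
      (re, im, rad, ab, n2OfA ab rad)

/-- the direction table. -/
def dscTab (L : ℕ) (S : XBScal) (mt : List (List (Iv × Iv))) (ct ct4 : List Iv) (j : ℕ) :
    List (List (Iv × Iv × Iv × Iv × Iv)) :=
  (List.range L).map fun k1 => (List.range L).map fun k2 => dscAt L S mt ct ct4 j k1 k2

/-- the cross term `Re(conj φ̂ φ̂′)`-bracket from two tabulated discs (cf. `crossOf`). -/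
def crossOfA (d1 d2 : Iv × Iv × Iv × Iv × Iv) : Iv :=
  match d1, d2 with
  | (re1, im1, r1, a1, _), (re2, im2, r2, a2, _) =>
    let base := iadd (imul re1 re2) (imul im1 im2)
    let dev := iadd (iadd (imul a1 (ipm r2)) (imul a2 (ipm r1))) (imul (ipm r1) (ipm r2))
    iadd base (-(max dev.2 0), max dev.2 0)

/-! ## Objects from the tables -/

/-- `(Σ F₂³, Σ F₂² cos kₓ, Σ F₂² F₂(·+x̂))` in one pass. -/
def sumsF (L : ℕ) (mt : List (List (Iv × Iv))) (ct : List Iv) : Iv × Iv × Iv :=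
  (psum (fun k1 => psum (fun k2 =>
      let F := (getT mt k1 k2).1
      imul (imul F F) F) L) L,
   psum (fun k1 => psum (fun k2 =>
      let F := (getT mt k1 k2).1
      imul (imul F F) (getIv ct (k1 % L))) L) L,
   psum (fun k1 => psum (fun k2 =>
      let F := (getT mt k1 k2).1
      imul (imul F F) (getT mt ((k1 + 1) % L) k2).1) L) L)

/-- `Σ_k (|φ̂_{x̂}(k)|² + |φ̂_{ŷ}(k)|²) F₂(k)` (half of the four-direction sum). -/
def sumN2F2 (L : ℕ) (mt : List (List (Iv × Iv))) (d0 d2 : List (List (Iv × Iv × Iv × Iv × Iv))) : Iv :=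
  psum (fun k1 => psum (fun k2 =>
    imul (iadd (getT d0 k1 k2).2.2.2.2 (getT d2 k1 k2).2.2.2.2) (getT mt k1 k2).1) L) L

/-- the `J`-summand of one direction table at `k` (shift `+x̂`). -/
def jTerm (L : ℕ) (mt : List (List (Iv × Iv))) (d : List (List (Iv × Iv × Iv × Iv × Iv))) (k1 k2 : ℕ) : Iv :=
  let F := (getT mt k1 k2).1
  let Fx := (getT mt ((k1 + 1) % L) k2).1
  iadd (imul (crossOfA (getT d k1 k2) (getT d ((k1 + 1) % L) k2)) (iadd F Fx)) (imul (getT d k1 k2).2.2.2.2 Fx)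

/-- `J_{x̂} + J_{ŷ}` (half of the four-direction sum). -/
def sumJ2 (L : ℕ) (mt : List (List (Iv × Iv))) (d0 d2 : List (List (Iv × Iv × Iv × Iv × Iv))) : Iv :=
  psum (fun k1 => psum (fun k2 => iadd (jTerm L mt d0 k1 k2) (jTerm L mt d2 k1 k2)) L) L

/-- ★ the five objects `(B, P, A, Q, B_C)` from the tables (same brackets as `xbObj`, four directions folded onto two). -/
def xbObj2 (L : ℕ) (S : XBScal) (gt tt : List (List Iv)) (ct ct4 : List Iv) : XBObj :=
  let V : ℤ := (L : ℤ) * L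
  let mt := momTab L S gt tt
  let d0 := dscTab L S mt ct ct4 0
  let d2 := dscTab L S mt ct ct4 2
  match sumsF L mt ct with
  | (s3, s2c, s2x) =>
    { B := idivn (iscale 6 s2x) V,
      P := idivn s3 V,
      A := idivn s2c V,
      Q := ineg (idivn (iscale 3 (iscale 2 (sumN2F2 L mt d0 d2))) (2 * V)),
      C := ineg (idivn (iscale 3 (iscale 2 (sumJ2 L mt d0 d2))) V) }

/-! ## The certificate -/

/-- ★ scalars and objects of the cell `[la, lb]` from the two point wedges `tlo` (at `la`) and `thi` (at `lb`). -/
def xbEval2 (L : ℕ) (la lb : ℤ) (tlo thi : List (List Iv)) : XBScal × XBObj :=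
  let gt := gresCellTab L (cosTab L) la lb
  let S := xbScal L la lb gt
  (S, xbObj2 L S gt (tTab2 L tlo thi) (cosTab L) (cosTab (4 * L)))

/-- ★ THE XB2 CELL CERTIFICATE of the row-`N₁` crux at this `L` on `[la, lb]` with constant `cmin`, given the two point wedges:
ground-cell check, `1 − Δ > 0`, nonnegative lower point table, `P⁻ > 0`, `0 ≤ cmin`, `cmin·3V²·T⁺⁺ ≤ N₁⁻`. -/
def xbCellOK2 (L : ℕ) (la lb : ℤ) (cmin : ℚ) (tlo thi : List (List Iv)) : Bool :=
  let E := xbEval2 L la lb tlo thi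
  groundCellCheck L la lb && xbScalOK L la lb && gPtNonneg L la &&
    decide (0 < E.2.P.1) && decide (0 ≤ cmin) &&
    decide (cmin * (((3 * ((L : ℤ) * L) ^ 2 * tPlusHi E.1 E.2 : ℤ)) : ℚ) ≤ ((n1Lo E.1 E.2 : ℤ) : ℚ))

/-- one cell of the cover, given the point wedges: numerator-vacuous, `Δ`-vacuous on either side of `(0, Δ₁]`, or certified. -/
def xbCellAnyT (L : ℕ) (d1 : ℚ) (la lb : ℤ) (c : ℚ) (tlo thi : List (List Iv)) : Bool :=
  (denCellPos L (cosTab L) la lb && decide ((numIv L la lb).2 < 0) && decide (0 ≤ (G0Iv L la lb).1)) ||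
  (groundCellCheck L la lb &&
    (decide ((deltaIv L la lb).2 < 0) || decide (d1 * (D : ℚ) < (((deltaIv L la lb).1 : ℤ) : ℚ)))) ||
  xbCellOK2 L la lb c tlo thi

/-- ★ one cell of the cover with the point wedges recomputed (a kernel fact `xbCellAny2 … = true` may instead rewrite
`tWedgePt L la`, `tWedgePt L lb` to certified literal tables and decide `xbCellAnyT`). -/
def xbCellAny2 (L : ℕ) (d1 : ℚ) (la lb : ℤ) (c : ℚ) : Bool :=
  xbCellAnyT L d1 la lb c (tWedgePt L la) (tWedgePt L lb)

/-- ★ THE PER-`L` ROW-`N₁` CERTIFICATE (XB2) on `0 < Δ ≤ Δ₁`: points start at `0`, end `≥ lamTop L`, every cell passes `xbCellAny2`. -/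
def xbCheck2 (L : ℕ) (d1 : ℚ) (cells : List (ℤ × ℚ)) : Bool :=
  decide ((cells.head?.map Prod.fst) = some 0) && decide (2 ≤ cells.length) && decide (lamTop L ≤ cellsLastQ cells)
    && cellsAllQ (xbCellAny2 L d1) cells

end FinXB

end Summit.HubbardSuperconductivity.HubbardSuperconductivity.Theorems.AnisotropyChord.Transfer.Fibre3
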